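import Summits.QuantumFields.BalabanUV.Beta.FP.TowerQN2RowCopies
import Summits.QuantumFields.BalabanUV.Beta.NVertexEvenBorderTorus

/-!
# `BalabanUV.Beta.FP.TowerQN2Row` — road «FP», binder row D1, ROUTE T (β1), (E4e²) PART 7: **THE END WRAPPER v5's SECOND-ORDER CONTENT ROW `hQN₂` AT ONE LABEL PAIR, FROM THE
# ROAD's DATA, MODULO ONE SCALAR LOCK ROW** — with (H) `TowerQN2RowCopies.Qprime2_symm_apply_eq_sum_sum_perF_dper_copies` on the left (`= (c²·r·r·Σ_full) ·` the double
# column-weighted sum `D(a,a′)`) and the row's PART 20 `NVertexEvenBorderTorus.perF_dper_wound_WN_evenHalf_inr_inl_eq_sum` on the right (on the multiplier–field block the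
# periodised wound EVEN N-family is `−Pn.cB (n+2) ·` the SAME double sum — an2 g68 J-NOTE-11: mixed words zero, response word subtracted by the even half, the border bi-vertex
# table `compVh2Sˢ` = (H)'s packed `K₂ˢ` definitionally), v5's row «`½•(𝔔′₂f (r•e_a) (r•e_{a′}) + 𝔔′₂f (r•e_{a′}) (r•e_a)) = Ŵ♮_wound.sub fN e_F`» HOLDS under the single
# second-order LOCK ROW **`hcB : c²·r·r·Σ_full^{(n+2)} = −Pn.cB (n+2)`** (SPEC-54 §5; with #4's first-order lock `c·r·Σ_full = Pn.cVH (n+2)`: `Pn.cB (n+2) = −cVH²∕Σ_full`, the sign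
# from `atw`) — the second-order twin of #4 `TowerQN1Row.hQN1_of_road_data`

WHY (journal l.67805 an2 J-NOTE-11, l.67814 road A-4, l.67818 INTENT-3, l.67819 an2 INTENT-7).  The junction of `hQN₂` (road `TowerQN2RowWound.hQN2_row_iff_junction`) is ONE
scalar identity once both sides are the same double sum: no left peel, no K1 contraction, no response-word match (those belong to the H row).
WHAT ([folklore] `Matrix`∕`Finset` bookkeeping BY NAME; no `def`, no `def … : Prop`, nothing cited, 0 sorry; (H) §2's letters VERBATIM): §1 **`hQN2_of_lock_of_reading`** — the row
from (H) + a DISPLAYED single-orientation torus reading `hWNμf` (EXACTLY PART 20's conclusion at `R := Roots.ctr Lc`, `P := Pn`, `j := n+1`, box `T`, `M′ := M`, labels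
`(μN a, yN a; μN a′, yN a′)`, every multiplier row `p`) + `hcB` (`Matrix.ext`; (H); `hfN`; the reading; `← hcB`; the two double sums agree term by term by `rfl` on
`compVh2S ∕ symVh2KerSymAt ∕ Roots.ctr`); §2 **`hQN2_of_lock`** — the same with PART 20 CONSUMED BY NAME (`hM := towerTorus_fine_apply M n`): v5's `hQN₂ n (μN a) (yN a) (μN a′) (yN a′) B`
per box AS A THEOREM at the road's data modulo `hcB` alone.
WHAT THIS IS NOT: not the lock's VALUE (a junction condition on the free pin `Pn.cB (n+2)`, displayed); not the H row `hHN₂` (order-2 Hessian-table word, J-NOTE-10); not the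
`∀ μ y ν y′` family form (`TowerQN2RowFamily`); nothing of Bałaban's asserted, valued or discharged; 0 estimates; 0∕4 row-D1 binders (hW, hR, D1Tel, D1Rep); ROOT M‴ p325680 ∕
P5c ∕ D6 untouched; NOT (C1), NOT (T-ID), NOT D1, NEVER «G-an2-4 closed», NOT BetaPertH, NOT continuum, NOT Clay.

HONEST DEPENDENCY (page 1, mandatory): continuum YM on T⁴ ⇐ BetaPertH ∧ nine spine estimates (0/9 proved); BetaPertH ⇐ (D1) ∧ (D4) ∧ CAP+tail;
G-an2-4 gates asym, D1 and NE2/3/4.  HONEST FRAMING (cell contract, verbatim): «discharging `BetaPertH` makes Bałaban's UV stability UNCONDITIONAL —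
a real constructive-QFT result; it is NOT the continuum limit and NOT the Clay problem.»  ABSOLUTE RULE (cell charter, verbatim): «No internally-minted
statement may enter as a cited fact. Every hypothesis is either kernel-proved in this package or a verbatim quotation of a PUBLISHED theorem with page
reference. The manuscript(s) under audit are NOT citable for their own disputed steps — they are the thing under adjudication; programme-internal
(2001/route/tribunal) claims are never citable.»  Road «FP» OWNER, b2b-balaban-beta-d1-p3 gen 44, 2026-08-27.  No existing file touched.
-/

noncomputable section

open scoped BigOperators

namespace Summit.QuantumFields.BalabanUV.Beta.FP.TowerQN2Row

open Finset Matrix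
open Literature.MathematicalPhysics.QuantumFieldTheory
open Literature.MathematicalPhysics.QuantumFieldTheory.Balaban1983to89
open Literature.MathematicalPhysics.QuantumFieldTheory.Balaban1983to89.Beta
open B4TorusKernel.MultiPeriod (translate)
open B5Prop11Plancherel (fine)
open B6Lemma24Torus (pbox)
open AffineAveraging (Site box toSite)
open AveragingContoursRooted (ctr ctrOff)
open AveragingHessianKernels (packVH)
open ExpKernelCalculus (MKer)
open OneStepResolventKernel (Fib)
open Summit.QuantumFields.BalabanUV.Beta.TameKernelCalculus (trK)
open Summit.QuantumFields.BalabanUV.Beta.BorderedHessian (sgnK)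
open Summit.QuantumFields.BalabanUV.Beta.BorderedHessian (stepScale)
open Summit.QuantumFields.BalabanUV.Beta.SymAveragingHessianCounts (symLinKerAt symVhKerAt)
open Summit.QuantumFields.BalabanUV.Beta.SymAveragingMixedJetTables (symVh2KerAt)
open Summit.QuantumFields.BalabanUV.Beta.CompositeVertexKernelRec (compVH2Ker compVh2S)
open Summit.QuantumFields.BalabanUV.Beta.CompositeVertexKernelBoundsTwoSym (symVh2KerSymAt)
open Summit.QuantumFields.BalabanUV.Beta.CompositeOneShotJetData (Roots Pins AN WN)
open Summit.QuantumFields.BalabanUV.Beta.FP.KernelPeriodisationFib (Idx perF)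
open Summit.QuantumFields.BalabanUV.Beta.FP.KernelPeriodisationFibLoc (dper)
open Summit.QuantumFields.BalabanUV.Beta.FP.TorusGaugeCovariance (tgrad)
open Summit.QuantumFields.BalabanUV.Beta.FP.TorusGaugeCovariancePairing (wrapPt)
open Summit.QuantumFields.BalabanUV.Beta.FP.TorusCompositeObjects (towerTorus)
open Summit.QuantumFields.BalabanUV.Beta.FP.TorusCompositeCovariance (itRoot)
open Summit.QuantumFields.BalabanUV.Beta.FP.TorusCompositeObjectsG (compRowsSym)
open Summit.QuantumFields.BalabanUV.Beta.FP.TorusCompositeCovarianceOneSym (compIns₁Sym)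
open Summit.QuantumFields.BalabanUV.Beta.FP.TorusCompositeCovarianceTwoPolarSym (compIns₂₂Sym)
open Summit.QuantumFields.BalabanUV.Beta.FP.TowerQN2RowCopies (towerTorus_fine_apply Qprime2_symm_apply_eq_sum_sum_perF_dper_copies)
open Summit.QuantumFields.BalabanUV.Beta.NVertexEvenBorderTorus (perF_dper_wound_WN_evenHalf_inr_inl_eq_sum)

section Row

variable {Lc : ℕ} [NeZero Lc] (M : Fin (3 + 1) → ℕ) [∀ μ, NeZero (M μ)] (n : ℕ) (c : ℝ) (Pn : Pins)
  -- (H) `TowerQN2RowCopies` §2's letters VERBATIM: the slot map, the root, the labels, #6's 𝔔-side namings, the pinned directions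
variable (fN : (↥(pbox M) × Fin (3 + 1)) → Idx (towerTorus Lc (fine Lc M) (n + 1)) (Fib 3))
  (hfN : ∀ a : ↥(pbox M) × Fin (3 + 1),
    fN a = (wrapPt (towerTorus Lc (fine Lc M) (n + 1)) (((Lc ^ (n + 1 + 1) : ℕ) : ℤ) • (a.1 : Site (3 + 1))), Sum.inr a.2))
variable (hc : ctrOff (3 + 1) Lc ∈ box (3 + 1) Lc)
  {κ : Type*} [Fintype κ] [DecidableEq κ] (yN : κ → Site (3 + 1)) (μN : κ → Fin (3 + 1))
  (hv : (κ → ℝ) → (↥(pbox (towerTorus Lc (fine Lc M) (n + 1))) × Fin (3 + 1) → ℝ))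
  (hhvl : ∀ (r : ℝ) (x y : κ → ℝ), hv (r • x + y) = r • hv x + hv y)
  (lv : (κ → ℝ) → ↥(pbox (towerTorus Lc (fine Lc M) (n + 1))) → ℝ)
  (hlv : ∀ (r : ℝ) (x y : κ → ℝ), lv (r • x + y) = r • lv x + lv y)
  (hJW : ∀ (a : κ) (b : ↥(pbox (towerTorus Lc (fine Lc M) (n + 1))) × Fin (3 + 1)), hv (Pi.single a 1) b
      = perF (towerTorus Lc (fine Lc M) (n + 1)) (AN (Roots.ctr Lc) (n + 1)) (b.1, Sum.inl b.2)
          (wrapPt (towerTorus Lc (fine Lc M) (n + 1)) (((Lc ^ (n + 1 + 1) : ℕ) : ℤ) • yN a), Sum.inr (μN a))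
        - ∑ s : ↥(pbox (towerTorus Lc (fine Lc M) (n + 1))), tgrad (towerTorus Lc (fine Lc M) (n + 1)) (b.1, Sum.inl b.2) s * lv (Pi.single a 1) s)
  (𝔔₀ : Matrix ((↥(pbox M) × Fin (3 + 1))) (↥(pbox (towerTorus Lc (fine Lc M) (n + 1))) × Fin (3 + 1)) ℝ)
  (h𝔔₀' : 𝔔₀ = (compRowsSym Lc M (fun i : ℕ => n + 1 - (i - 1)) (fun _ : ℕ => ctrOff (3 + 1) Lc) (n + 1 + 1) :
      Matrix ((↥(pbox M) × Fin (3 + 1))) (↥(pbox (towerTorus Lc (fine Lc M) (n + 1))) × Fin (3 + 1)) ℝ))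
  (𝔔₁f : (κ → ℝ) → Matrix ((↥(pbox M) × Fin (3 + 1))) (↥(pbox (towerTorus Lc (fine Lc M) (n + 1))) × Fin (3 + 1)) ℝ)
  (h𝔔₁' : ∀ v, 𝔔₁f v = c • compIns₁Sym Lc M (fun i : ℕ => n + 1 - (i - 1)) (fun _ : ℕ => ctrOff (3 + 1) Lc) (n + 1 + 1) (hv v))
  (𝔔₂f : (κ → ℝ) → (κ → ℝ) → Matrix ((↥(pbox M) × Fin (3 + 1))) (↥(pbox (towerTorus Lc (fine Lc M) (n + 1))) × Fin (3 + 1)) ℝ)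
  (h𝔔₂' : ∀ v v', (1 / 2 : ℝ) • (𝔔₂f v v' + 𝔔₂f v' v)
    = c ^ 2 • compIns₂₂Sym Lc M (fun i : ℕ => n + 1 - (i - 1)) (fun _ : ℕ => ctrOff (3 + 1) Lc) (n + 1 + 1) (hv v) (hv v'))
  (Xbf : (κ → ℝ) → Matrix ((↥(pbox M) × Fin (3 + 1))) ((↥(pbox M) × Fin (3 + 1))) ℝ)
  (hXbf : ∀ v, Xbf v = c • Matrix.diagonal (fun a : (↥(pbox M) × Fin (3 + 1)) =>
    lv v (itRoot Lc M (fun _ : ℕ => ctrOff (3 + 1) Lc) (fun _ => hc) (n + 1 + 1) a.1)))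
  (𝔔'₂f : (κ → ℝ) → (κ → ℝ) → Matrix ((↥(pbox M) × Fin (3 + 1))) (↥(pbox (towerTorus Lc (fine Lc M) (n + 1))) × Fin (3 + 1)) ℝ)
  (h𝔔'₂f : ∀ v v', 𝔔'₂f v v' = Xbf v * Xbf v' * 𝔔₀ + (Xbf v * 𝔔₁f v' + Xbf v * 𝔔₀ * (-(c • Matrix.diagonal (fun b : (↥(pbox (towerTorus Lc (fine Lc M) (n + 1))) × Fin (3 + 1)) => lv v' b.1))))
      + ((Xbf v * 𝔔₁f v' + Xbf v * 𝔔₀ * (-(c • Matrix.diagonal (fun b : (↥(pbox (towerTorus Lc (fine Lc M) (n + 1))) × Fin (3 + 1)) => lv v' b.1)))) + (𝔔₂f v v' + 𝔔₁f v * (-(c • Matrix.diagonal (fun b : (↥(pbox (towerTorus Lc (fine Lc M) (n + 1))) × Fin (3 + 1)) => lv v' b.1))) + (𝔔₁f v * (-(c • Matrix.diagonal (fun b : (↥(pbox (towerTorus Lc (fine Lc M) (n + 1))) × Fin (3 + 1)) => lv v' b.1))) + 𝔔₀ * ((-(c • Matrix.diagonal (fun b : (↥(pbox (towerTorus Lc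 (fine Lc M) (n + 1))) × Fin (3 + 1)) => lv v b.1))) * (-(c • Matrix.diagonal (fun b : (↥(pbox (towerTorus Lc (fine Lc M) (n + 1))) × Fin (3 + 1)) => lv v' b.1))))))))
  (r : ℝ) (a a' : κ)
  -- THE SECOND-ORDER LOCK ROW on the free pin `Pn.cB (n+2)` (SPEC-54 §5; J-NOTE-11)
  (hcB : c ^ 2 * r * r * ∏ ℓ ∈ range (n + 1 + 1), (stepScale 3 Lc ℓ * ((box (3 + 1) Lc).card : ℝ)) = -(Pn.cB (n + 1 + 1)))

/-! ## §1 From a displayed single-orientation torus reading (PART 20's shape) -/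

omit [Fintype κ] in
include hfN hhvl hlv hJW h𝔔₀' h𝔔₁' h𝔔₂' hXbf h𝔔'₂f hcB in
/-- [folklore] **`hQN2_of_lock_of_reading` — v5's ROW `hQN₂` AT THE LABEL PAIR `(μN a, yN a; μN a′, yN a′)`, PER BOX, FROM THE ROAD's DATA AND A DISPLAYED READING**: for #6's letters,
the slot map `fN`, the single-orientation torus reading `hWNμf` of the wound even family's multiplier–field block (the row's PART 20, displayed in its exact shape) and the lock `hcB`,
`½•(𝔔′₂f (r•e_a) (r•e_{a′}) + 𝔔′₂f (r•e_{a′}) (r•e_a)) = (perF T (dper T (x w ↦ Σ'_e WN♮ (μN a) (yN a) (μN a′) (translate M (yN a′) e) x w))).submatrix fN e_F`. -/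
theorem hQN2_of_lock_of_reading
    (hWNμf : ∀ (p q : ↥(pbox (towerTorus Lc (fine Lc M) (n + 1)))) (m₁ β : Fin (3 + 1)),
      perF (towerTorus Lc (fine Lc M) (n + 1)) (dper (towerTorus Lc (fine Lc M) (n + 1))
          (fun X Z i₁ i₂ => ∑' e : Site (3 + 1), ((1 / 2 : ℝ) • (WN (Roots.ctr Lc) Pn (n + 1) (μN a) (yN a) (μN a') (translate M (yN a') e)
            + sgnK (trK (WN (Roots.ctr Lc) Pn (n + 1) (μN a) (yN a) (μN a') (translate M (yN a') e))))) X Z i₁ i₂)) (p, Sum.inr m₁) (q, Sum.inl β)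
        = -(Pn.cB (n + 1 + 1)) * (∑ b : ↥(pbox (towerTorus Lc (fine Lc M) (n + 1))) × Fin (3 + 1), ∑ b' : ↥(pbox (towerTorus Lc (fine Lc M) (n + 1))) × Fin (3 + 1),
          (perF (towerTorus Lc (fine Lc M) (n + 1)) (AN (Roots.ctr Lc) (n + 1)) (b.1, Sum.inl b.2) (wrapPt (towerTorus Lc (fine Lc M) (n + 1)) (((Lc ^ (n + 1 + 1) : ℕ) : ℤ) • (yN a)), Sum.inr (μN a))
            * perF (towerTorus Lc (fine Lc M) (n + 1)) (AN (Roots.ctr Lc) (n + 1)) (b'.1, Sum.inl b'.2) (wrapPt (towerTorus Lc (fine Lc M) (n + 1)) (((Lc ^ (n + 1 + 1) : ℕ) : ℤ) • (yN a')), Sum.inr (μN a')))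
            • perF (towerTorus Lc (fine Lc M) (n + 1)) (dper (towerTorus Lc (fine Lc M) (n + 1)) (fun x z a c => ∑' e : Site (3 + 1),
                (compVh2S (fun _ : ℕ => symLinKerAt (toSite (Roots.ctr Lc).r) Lc) (fun _ : ℕ => symVhKerAt (toSite (Roots.ctr Lc).r) Lc) (fun _ : ℕ => symVh2KerSymAt (toSite (Roots.ctr Lc).r) Lc) Lc (n + 1 + 1)) b.2 (b.1 : Site (3 + 1)) b'.2 (translate (towerTorus Lc (fine Lc M) (n + 1)) (b'.1 : Site (3 + 1)) e) x z a c)))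
          (p, Sum.inr m₁) (q, Sum.inl β)) :
    (1 / 2 : ℝ) • (𝔔'₂f (r • (Pi.single a (1 : ℝ) : κ → ℝ)) (r • (Pi.single a' (1 : ℝ) : κ → ℝ))
          + 𝔔'₂f (r • (Pi.single a' (1 : ℝ) : κ → ℝ)) (r • (Pi.single a (1 : ℝ) : κ → ℝ)))
      = (perF (towerTorus Lc (fine Lc M) (n + 1)) (dper (towerTorus Lc (fine Lc M) (n + 1))
          (fun X Z i₁ i₂ => ∑' e : Site (3 + 1), ((1 / 2 : ℝ) • (WN (Roots.ctr Lc) Pn (n + 1) (μN a) (yN a) (μN a') (translate M (yN a') e)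
            + sgnK (trK (WN (Roots.ctr Lc) Pn (n + 1) (μN a) (yN a) (μN a') (translate M (yN a') e))))) X Z i₁ i₂))).submatrix fN
          (fun b : ↥(pbox (towerTorus Lc (fine Lc M) (n + 1))) × Fin (3 + 1) => ((b.1, Sum.inl b.2) : Idx (towerTorus Lc (fine Lc M) (n + 1)) (Fib 3))) := by
  refine Matrix.ext fun p q => ?_
  obtain ⟨x, κ₀⟩ := p
  obtain ⟨z, β⟩ := q
  rw [Qprime2_symm_apply_eq_sum_sum_perF_dper_copies M n c fN hfN hc yN μN hv hhvl lv hlv hJW 𝔔₀ h𝔔₀' 𝔔₁f h𝔔₁' 𝔔₂f h𝔔₂' Xbf hXbf 𝔔'₂f h𝔔'₂f r a a' x κ₀ z β,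
    Matrix.submatrix_apply, hfN (x, κ₀), hWNμf, ← hcB]
  simp only [Matrix.sum_apply, Matrix.smul_apply, smul_eq_mul]
  refine congrArg (HMul.hMul _) (Finset.sum_congr rfl fun b _ => Finset.sum_congr rfl fun b' _ => ?_)
  rw [mul_assoc]
  rfl

/-! ## §2 With the row's PART 20 consumed by name -/

omit [Fintype κ] in
include hfN hhvl hlv hJW h𝔔₀' h𝔔₁' h𝔔₂' hXbf h𝔔'₂f hcB in
/-- [folklore] **`hQN2_of_lock` — v5's ROW `hQN₂ n (μN a) (yN a) (μN a′) (yN a′) B` PER BOX IS A THEOREM AT THE ROAD's DATA MODULO THE LOCK ROW `hcB` ALONE**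
(`hQN2_of_lock_of_reading` fed an2 PART 20 `NVertexEvenBorderTorus.perF_dper_wound_WN_evenHalf_inr_inl_eq_sum` at `hM := towerTorus_fine_apply M n`). -/
theorem hQN2_of_lock :
    (1 / 2 : ℝ) • (𝔔'₂f (r • (Pi.single a (1 : ℝ) : κ → ℝ)) (r • (Pi.single a' (1 : ℝ) : κ → ℝ))
          + 𝔔'₂f (r • (Pi.single a' (1 : ℝ) : κ → ℝ)) (r • (Pi.single a (1 : ℝ) : κ → ℝ)))
      = (perF (towerTorus Lc (fine Lc M) (n + 1)) (dper (towerTorus Lc (fine Lc M) (n + 1))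
          (fun X Z i₁ i₂ => ∑' e : Site (3 + 1), ((1 / 2 : ℝ) • (WN (Roots.ctr Lc) Pn (n + 1) (μN a) (yN a) (μN a') (translate M (yN a') e)
            + sgnK (trK (WN (Roots.ctr Lc) Pn (n + 1) (μN a) (yN a) (μN a') (translate M (yN a') e))))) X Z i₁ i₂))).submatrix fN
          (fun b : ↥(pbox (towerTorus Lc (fine Lc M) (n + 1))) × Fin (3 + 1) => ((b.1, Sum.inl b.2) : Idx (towerTorus Lc (fine Lc M) (n + 1)) (Fib 3))) :=
  hQN2_of_lock_of_reading M n c Pn fN hfN hc yN μN hv hhvl lv hlv hJW 𝔔₀ h𝔔₀' 𝔔₁f h𝔔₁' 𝔔₂f h𝔔₂' Xbf hXbf 𝔔'₂f h𝔔'₂f r a a' hcB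
    (fun p q m₁ β => perF_dper_wound_WN_evenHalf_inr_inl_eq_sum (Roots.ctr Lc) Pn (n + 1) (towerTorus Lc (fine Lc M) (n + 1)) (towerTorus_fine_apply M n)
      (μN a) (yN a) (μN a') (yN a') p q m₁ β)

end Row

end Summit.QuantumFields.BalabanUV.Beta.FP.TowerQN2Row

end
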